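import Literature.AlgebraicGeometry.Deformation.ContractedDlogCocycleSpan
import Literature.AlgebraicGeometry.AbelianVarieties.CechH1DimOfCharZeroByTransport
import Literature.AlgebraicGeometry.Motives.AbelianVarietyCotangentSheafFreeHolds
import Literature.AlgebraicGeometry.Motives.HodgeSheavesFree
import HarnessLib

/-!
# `φ_L : Lie(A) → H¹(A, 𝒪_A)` injective ⇒ onto, for an abelian variety in characteristic `0` (chart form)

Topic `AlgebraicGeometry/AbelianVarieties`.  THEOREMS ONLY (no `def`, no instance, no `sorry`).  Cell hodgecm-mathlib,
F-11 α1-(iii-c-2) ∕ (I2): the dimension count of [MumfordAV1970] §13 (proof of the Theorem, pp. 125–130; Cor. 2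
p. 129 `dim H¹(A, 𝒪_A) = g`) in the chart dialect of `Deformation/PairLiftObstructionMove`.

For an abelian variety `A` over a field `k` of characteristic `0`, a finite affine open cover `U`, a module `L`
presented by rank-one frames `F : IFrames L U` (transition units `g_{jl} = F.tf j l`), and a Čech `1`-cocycle `c`
of `𝒪_A` on `U`:

* **`AbelianVariety.exists_vectorField_of_cechOneCocycle_of_injective`** — IF every global vector field
  `D : Ω¹_{A/k}|_⊤ → 𝒪_A|_⊤` whose contracted `dlog`-cochain `g_{jl}⁻¹ · D(dg_{jl})` is a Čech coboundary vanishes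
  (injectivity of `φ_L` on `Lie(A) = H⁰(A, 𝒯_A)`, the letter of (I2-a) `AbelianSchemes/PhiLInjectiveCharZero`), THEN
  `c_{jl} = g_{jl}⁻¹ · D(dg_{jl}) + (h_l| − h_j|)` for some global vector field `D` and `0`-cochain `h` (`φ_L` onto).

Ingredients, all ★: the generic rank–nullity engine `Deformation.exists_eq_contractedDlog_add_of_injective_of_finrank_le`;
`Ω¹_{A/k} ≅ 𝒪_A^{dim A}` (`Motives.Mumford1970_cotangentSheaf_abelianVariety_free_holds`, [MumfordAV1970] §4 (iii)), whence a
global frame of `Ω¹|_⊤` with `dim A` elements (`Motives.nonempty_free_iso_over_of_iso_free`); and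
`dim_k Ȟ¹(U, 𝒪_A) = dim A` on every finite affine open cover in characteristic `0`
(`AbelianVarieties.finrank_cechH1_structureSheaf_eq_dim_of_charZero`, [MumfordAV1970] §13 Cor. 2 by Lefschetz transport).
No embedding `k ↪ ℂ` is assumed.  HC_CM is proved only modulo the 7 printed citations until rung 0 closes; this file is
generic abelian-variety geometry and asserts nothing about HC.

## References
* [MumfordAV1970] D. Mumford, *Abelian Varieties* (1970), §4 (iii) (p. 42); §13, proof of the Theorem (pp. 125–130) and Cor. 2 (p. 129).
* [Oort1971] F. Oort, *Finite group schemes, local moduli for abelian varieties, and lifting problems* (1971), §2.3.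
-/

noncomputable section

open CategoryTheory AlgebraicGeometry Opposite TopologicalSpace

namespace Literature.AlgebraicGeometry.AbelianVarieties

open Literature.AlgebraicGeometry.Motives Literature.AlgebraicGeometry.Modules
  Literature.AlgebraicGeometry.Morphisms Literature.AlgebraicGeometry.HodgeTheory
  Literature.AlgebraicGeometry.Deformation

/-- **`φ_L` injective ⇒ `φ_L` onto (chart form), for an abelian variety `A` over a field of characteristic `0`.**
With `U` a finite affine open cover, `F : IFrames L U` rank-one frames (`g_{jl} = F.tf j l`, `g_{jl}⁻¹ = F.tfOn l j _`):
if every global vector field `D` with `g_{jl}⁻¹ · D(dg_{jl}) = h_l| − h_j|` for some `0`-cochain `h` is zero, then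
every Čech `1`-cocycle `c` of `𝒪_A` on `U` (cocycle identity in the shape of `Morphisms.cechD1`) satisfies
`c_{jl} = g_{jl}⁻¹ · D(dg_{jl}) + (h_l| − h_j|)` for some global vector field `D` and `0`-cochain `h`.  Dimension
count: `Lie(A) ≅ k^{dim A}` via the free `Ω¹_{A/k}` and `dim_k Ȟ¹(U, 𝒪_A) = dim A`.
[cite: MumfordAV1970, §13, proof of the Theorem (pp. 125–130) and Cor. 2 (p. 129)] [cite: Oort1971, §2.3] -/
theorem AbelianVariety.exists_vectorField_of_cechOneCocycle_of_injective {k : Type} [Field k] [CharZero k]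
    (A : AbelianVariety k) {L : A.X.left.Modules}
    {ι : Type} [Finite ι] (U : ι → A.X.left.affineOpens) (hcov : ⨆ j, (U j).1 = ⊤)
    (F : IFrames L (fun j => (U j).1))
    (hinj : ∀ (D : (cotangentSheaf A.X).over ⊤ ⟶ (unitModule A.X.left).over ⊤) (h : (j : ι) → Γ(A.X.left, (U j).1)),
      (∀ j l : ι,
        F.tfOn l j ((U j).1 ⊓ (U l).1) inf_le_right inf_le_left *
            (show Γ(A.X.left, (U j).1 ⊓ (U l).1) from
              appLE D (homOfLE le_top) (dSection A.X ((U j).1 ⊓ (U l).1) (F.tf j l))) =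
          A.X.left.presheaf.map (homOfLE (inf_le_right : (U j).1 ⊓ (U l).1 ≤ (U l).1)).op (h l) -
            A.X.left.presheaf.map (homOfLE (inf_le_left : (U j).1 ⊓ (U l).1 ≤ (U j).1)).op (h j)) → D = 0)
    (c : (j l : ι) → Γ(A.X.left, (U j).1 ⊓ (U l).1))
    (hc : ∀ j l m : ι,
      A.X.left.presheaf.map (homOfLE (inf_le_left : (U j).1 ⊓ (U l).1 ⊓ (U m).1 ≤ (U j).1 ⊓ (U l).1)).op (c j l) +
          A.X.left.presheaf.map (homOfLE (le_inf (inf_le_left.trans inf_le_right) inf_le_right :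
            (U j).1 ⊓ (U l).1 ⊓ (U m).1 ≤ (U l).1 ⊓ (U m).1)).op (c l m) =
        A.X.left.presheaf.map (homOfLE (le_inf (inf_le_left.trans inf_le_left) inf_le_right :
          (U j).1 ⊓ (U l).1 ⊓ (U m).1 ≤ (U j).1 ⊓ (U m).1)).op (c j m)) :
    ∃ (D : (cotangentSheaf A.X).over ⊤ ⟶ (unitModule A.X.left).over ⊤) (h : (j : ι) → Γ(A.X.left, (U j).1)),
      ∀ j l : ι, c j l =
        F.tfOn l j ((U j).1 ⊓ (U l).1) inf_le_right inf_le_left *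
            (show Γ(A.X.left, (U j).1 ⊓ (U l).1) from
              appLE D (homOfLE le_top) (dSection A.X ((U j).1 ⊓ (U l).1) (F.tf j l))) +
          (A.X.left.presheaf.map (homOfLE (inf_le_right : (U j).1 ⊓ (U l).1 ≤ (U l).1)).op (h l) -
            A.X.left.presheaf.map (homOfLE (inf_le_left : (U j).1 ⊓ (U l).1 ≤ (U j).1)).op (h j)) := by
  classical
  -- a global frame of `Ω¹_{A/k}` with `dim A` elements
  obtain ⟨eΩ⟩ := Mumford1970_cotangentSheaf_abelianVariety_free_holds k A
  obtain ⟨e⟩ := nonempty_free_iso_over_of_iso_free eΩ ⊤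
  -- `dim_k Ȟ¹(U, 𝒪_A) = dim A`
  obtain ⟨hfin, heq⟩ :=
    finrank_cechH1_structureSheaf_eq_dim_of_charZero A (fun j => (U j).1) (fun j => (U j).2) hcov
  haveI : Module.Finite k (CechH1 A.X.hom fun j => (U j).1) := hfin
  have hle : Module.finrank k (CechH1 A.X.hom fun j => (U j).1) ≤ Fintype.card (Fin A.dim) := by
    rw [Fintype.card_fin, heq]
  exact exists_eq_contractedDlog_add_of_injective_of_finrank_le (X := A.X) (fun j => (U j).1) F e hinj hle c hc

end Literature.AlgebraicGeometry.AbelianVarieties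

end
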